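import Mathlib
import HarnessLib
import HarnessLib.Audit
import Summits.AtomisticToContinuum.Statement

/-!
Route: RelayRaceLightCone

CLOSED (retired) 2026-08-15T13:45:56Z by operator:999:1257524 — reason: not-a-thesis: assembly does not conclude the sub-problem Statement — note: D-0027 §2.1 audit (human 2026-08-15: routes that do not decide the summit are removed): the assembly concludes `Literature.MathematicalPhysics.KineticTheory.HydrodynamicLimit`, not the sub-problem statement; a NEW conforming route may be opened from the same idea (generated `closes : … → _root_.Hydr. The file is kept as the record of this route; refuted decls are indexed as negative knowledge (`ledger negatives`).

# Route RelayRaceLightCone — a Lieb-Robinson light cone for billiard balls makes the hydrodynamic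
limit local — cone + near-constant short-time data + restart

X = LightConeInLaw ∧ NearConstantShortTimeHL ∧ RestartPrinciple ("it suffices to show").
LightConeInLaw (the ENGINE, card
relay-race-light-cone; two-copy phrasing and typed dockings grafted from the superseded sibling
influence-cone-disagreement-percolation):
for the fixed-density hard-sphere gas started from local Gibbs data there is a LIGHT CONE IN LAW
with an N-independent speed c = c(M)
(M bounds temperature and drift of the nominal pre-shock Euler fields, packing < η₀): the joint law
of the empirical density / momentum /
energy fields tested inside B(x₀, R − c t) at time t is asymptotically the same for any two such
systems (same sphere diameter, any particle
numbers) whose time-0 Euler data agree on B(x₀, R) in reduced units. NearConstantShortTimeHL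
(foreign input, shared with the near-equilibrium
cards): amplitude-δ₀(M) data with C¹ guards M follow classical hs-Euler for t < τ₀(M).
RestartPrinciple (foreign input, restart-principle /
FirstFailureBlowup currency): short-time guarded HL with an M-uniform step ⇒ the packing-guarded
conjunct. Glue (support ConeLocalisation):
flatten the profile outside B(x₀, 2r) at the matching density level, compare by the cone for t ≤
r/c, conclude by the near-constant theorem
and the Euler domain of dependence ⇒ short-time HL for ALL smooth profiles; restart to all t < T;
DiluteSelfConsistency (shared item
stmt-AtomisticToContinuum-3091) removes the packing guard.
Lean: `LightConeInLaw ∧ NearConstantShortTimeHL ∧ RestartPrinciple`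

## Assembly
Pure logic (proved sorry-free as `assembly_of_items` in Sketch.lean): ConeLocalisation applied to
the cone and the near-constant theorem gives
S; RestartPrinciple turns S into the packing-guarded conjunct with some η₀; DiluteSelfConsistency at
η := η₀ supplies the guard for
σ < σ₀' ; take σ₀ := min(σ₀(guarded), σ₀'(η₀)) profile by profile (the ImplosionLoophole
bookkeeping).

Rationale: WHY THIS LINE. The card imports the Lieb–Robinson architecture (path counting × per-bond bounds ×
Chernoff along the path; MarchioroEtAl1978, ButtaEtAl2007,
RazSims2009, NachtergaeleEtAl2008 for classical lattices) into the continuum hard-sphere gas at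
FIXED reduced density by measuring the span of
a causal (relay) chain in FLIGHT LENGTHS: the mean free path ℓ = (N+1)^(-1/3)/(√2πσ²) is geometric,
so Maxwellian tails drop out and the cone
speed is (links per unit time) × ℓ × (entropy of 2^k relay choices) = κ₁√θ, N-independent, with
tails e^(-cδσ²(N+1)^(1/3)) under Gibbs
(per-link inputs: Palm/GNZ structure of the low-activity hard-core state, Ruelle1969 Ch. 4,
GeorgiiZessin1993, Alexander1975 one-flight
clusters; coupling language of disagreement percolation doi:10.1214/aop/1176988728). What the cone
buys for the conjunct is LOCALITY: with a
light cone in law, the hydrodynamic limit for an arbitrary smooth profile over a short time is the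
hydrodynamic limit of a NEAR-CONSTANT
comparison gas (flattened profile, matching density level realised by another particle number at the
same diameter), i.e. the one regime
where perturbative / spectral tools exist (Spohn1991 §7.1), and the large-data problem becomes a
restart problem — the same currency as
route FirstFailureBlowup, whose 'MacroscopicLocality' child this route's engine supplies, and as
ImplosionLoophole's packing guard. No
existing route states a propagation bound; the negatives index is empty. Areas imported:
quantum/classical lattice locality bounds
(Lieb–Robinson), Gibbs point-process (Palm) theory, first-passage/branching-random-walk fronts,
hyperbolic domain-of-dependence PDE facts.

RANKED CRUXES. #2 LightConeInLaw (crux) — LIGHT CONE IN LAW (card relay-race-light-cone LR-G/M1–M5 +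
sibling graft G2/G3). ∃ η₀ ∀ M ∃ c > 0: for two hard-sphere systems on 𝕋³ with the SAME diameter
hsDiameter σ₁ N — system 1 the conjunct's (N+1 spheres, local Gibbs profile (a₁,u₁,θ₁), reduced
density σ₁) and system 2 any comparison gas (n₂(N) spheres, n₂·ε³ → σ₂³, local Gibbs profile
(a₂,u₂,θ₂)) — whose laws are probability measures with LLN at t = 0 towards classical hs-Euler data
(solutions on [0,T₁), [0,T₂)) that AGREE on the ball B(x₀,R) in reduced units (ρσ³, u, θ), and whose
nominal fields obey packing < η₀, θ ≤ M, |u| ≤ M on [0,t]: for every continuous χ vanishing outside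
B(x₀, R − c t) and every 1-Lipschitz F bounded by 1, E₁ F(reduced fields of Φ_t z against χ) − E₂
F(…) → 0 as N → ∞. Intended proof = the card: relay-race path counting (≤ 2^k chains), per-link
conditional Palm–Gibbs bounds (flight-length exponential moments, short-gap bound, ENERGY-SHARE
bound against focusing relays), Chernoff by iterated conditioning, union over seeds/time grid,
two-copy infection coupling; equilibrium case first (support EquilibriumLightCone), macroscopic
times via mesoscale channel/crowding regularity (card M2) or short-window matched-reference transfer
(M5). [difficulty: XL] (why it might fail: Needs per-link Palm–Gibbs bounds with an energy-share
bound (focusing relays, triage G1) and, out of equilibrium at macroscopic t, mesoscale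
channel/crowding regularity of the evolved law (card M2): sub-extensive events invisible to O(N)
entropy; guards sit on nominal Euler fields only.) [MarchioroEtAl1978, ButtaEtAl2007, RazSims2009,
NachtergaeleEtAl2008, Alexander1975, Ruelle1969, GeorgiiZessin1993, doi:10.1214/aop/1176988728,
Dorfman1999]
#3 NearConstantShortTimeHL (crux) — NEAR-CONSTANT SHORT-TIME HYDRODYNAMIC LIMIT, general
diameter/number families (foreign input; cf. FirstFailureBlowup's C²-small SmallDataHydrodynamics
stmt-3332 — here only C⁰-AMPLITUDE smallness δ₀(M) at t = 0 plus C¹ GUARDS M on [0,t], because the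
flattened comparison profiles of ConeLocalisation have O(1) gradients and O(1/r) second
derivatives). ∃ η₀ ∀ M ∃ δ₀, τ₀ > 0 ∀ continuous positive profiles ∃ σ₀ ∀ σ < σ₀ ∀ families (ε_N →
0, n_N ε_N³ → σ³) ∀ classical hs-Euler solutions with |ρ(0) − 1|, |u(0) − ū|, |θ(0) − θ̄| ≤ δ₀ ∀
flows: if the canonical local Gibbs laws are probability measures with LLN at 0, then for t < min(T,
τ₀), provided packing < η₀, θ ∈ [1/M, M], |u| ≤ M and all first Torus.partialDeriv ≤ M on [0,t], the
three empirical fields satisfy the LLN at t. [difficulty: open-problem] (why it might fail: It is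
the near-equilibrium hydrodynamic limit at fixed σ (relaxation of shear/sound/heat modes of
deterministic spheres; open even linearised, Spohn1991 §7.1 (7.13)-(7.18)), asked uniformly in M
with C¹ guards only; one O(1)-slow non-hydrodynamic mode near equilibrium kills it.) [Spohn1991,
BGSSCPAM2023, OllaVaradhanYau1993, Doyon2022]
#4 RestartPrinciple (crux) — RESTART: the short-time guarded hydrodynamic limit S (∃ η₀ ∀ M ∃ τ₁ >
0: for every profile/σ/classical solution of the conjunct's family with LLN at 0, the LLN holds at
every t < min(T, τ₁) at which packing < η₀, ρ ≤ M, θ ∈ [1/M, M], |u| ≤ M and all Torus.partialDeriv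
of (ρ,u,θ) up to order 3 are ≤ M on [0,t]) IMPLIES the packing-guarded conjunct (body of
HydroLimitInBand, stmt-3093: ∃ η₀ ∀ profiles ∃ σ₀ ∀ σ < σ₀ ∀ solutions with ρ_tσ³ < η₀ on [0,T), LLN
at 0 ⇒ LLN at all t < T). Content: a finite restart induction with step τ₁(M(t)) along the given
solution (M(t) = C³ bound on [0,t]); the law at a restart time is not local Gibbs, so S must be
re-proved in a restartable currency — entropy-close data (FirstFailureBlowup: ShortTimePropagation
3329, RestartEntropy 3330, ProfileRealisability 3331) or Liouville-pinned entropy (card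
restart-principle) — which for this route means the cone and the near-constant theorem under
mesoscale regularity of the TRUE law (card M2). [deps: NearConstantShortTimeHL] [difficulty: XL]
(why it might fail: The time-τ₁ law is not local Gibbs: o(N) relative entropy transfers only
e^(-cN)-rare events while cone/relaxation bounds are e^(-cN^(1/3)); restart needs S for
entropy-close data (3329-3331 currency) = mesoscale regularity along the true law, unproved.)
[Yau1991, OllaVaradhanYau1993, KipnisLandim1999, Spohn1991]
#9 ConeLocalisation (support) — GLUE (small ⇒ large for short times; sibling graft L2 without zoom):
LightConeInLaw → NearConstantShortTimeHL → S (S as in RestartPrinciple). Proof plan: given a profile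
with C³ bounds M on [0,t] and x₀, flatten the Euler data outside B(x₀,2r) by a cutoff at scale r
towards the constant state (ρ(0,x₀), u(0,x₀), θ(0,x₀)) (amplitude ≤ C M r, gradients ≤ C M); realise
it as system 2 with n₂(N) = ⌈ρ(0,x₀)(N+1)⌉ spheres of the same diameter (normalised density ≈ 1, σ₂
= ρ(0,x₀)^(1/3)σ) and a local Gibbs activity with LLN (statics: LocalGibbsDensityLimit 3097 /
LocalGibbsConcentration 0767); its classical solution lives ≥ c/M by scaling + H³ local theory
(Kato1975, Majda1984) and keeps C¹ norm ≤ C'M up to time r/c; Euler domain of dependence identifies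
it with the original solution inside the shrinking ball; the cone transfers the LLN for test
functions supported in B(x₀, r − c t), t ≤ τ₁ := min(τ₀(C'M), r/c(M)); a partition of unity over x₀
finishes. Needs no new definitions. [difficulty: L] [Kato1975, Majda1984, Sideris1985, Spohn1991,
Rauch1986]
#9 EquilibriumLightCone (support) — SPECIAL CASE & FIRST MILESTONE (card's equilibrium theorem LR-G
in two-copy form): LightConeInLaw with system 1 restricted to CONSTANT profiles (global Gibbs law,
invariant under every hard-sphere flow): the uninfected region ahead of the infection front then has
equilibrium statistics in both copies, so only STATIC Palm–Gibbs per-link bounds (card M1) and the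
relay-race assembly (M3) are needed — no channel regularity (M2). MD-testable (two-copy infection
front: speed κ₁√θ independent of φ at leading order, front width O(ℓ log N)). Implied by
LightConeInLaw (one-line, in Sketch.lean). [difficulty: XL] [MarchioroEtAl1978, Alexander1975,
Ruelle1969, Dorfman1999]
#9 DiluteSelfConsistency (support) — SHARED with route ImplosionLoophole
(stmt-AtomisticToContinuum-3091, verbatim signature; staffed there as its rank-3 crux, refutable
there by DenseExcursion 3090): for every η > 0 and all continuous positive profiles there is σ₀ such
that for σ < σ₀ every classical hs-Euler solution whose t = 0 fields are the LLN limit of the local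
Gibbs laws keeps packing ρ_tσ³ < η on [0,T). Used only to remove the packing guard at the very end;
if it is refuted the route re-targets the guarded conjunct HydroLimitInBand (stmt-3093) by a
one-line assembly restate. [difficulty: open-problem] [Sideris1985, LukSpeck2024, Spohn1991]

TWO-LAYER PLAN. Foreseen glued splits (k ≤ 3, depth 1), nothing filed now: LightConeInLaw ⇐
PalmLinkBounds (card M1: flight-length exponential moments,
short-gap bound, energy-share bound P(U > 1−η | past) ≤ Cη, uniformly in the chain's past σ-algebra
under Palm–Gibbs) → NonEquilibriumCone
(M2 channel/crowding regularity along the true law + M3 relay-race assembly + M5 short-window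
matched-reference transfer) → LightConeInLaw,
with EquilibriumLightCone (M1 + M3 only) as the first child to close. NearConstantShortTimeHL ⇐
LinearisedRelaxation (Euler-scale projection
onto the five charges: Doyon2022 framework + charge completeness, Spohn1991 (7.18)) →
SmallAmplitudeNonlinear → NearConstantShortTimeHL.
RestartPrinciple ⇐ ConeAndRelaxationForEntropyCloseData → (RestartEntropy 3330 +
ProfileRealisability 3331, shared) → RestartPrinciple.

KILL CRITERIA. ¬LightConeInLaw — an N-growing influence speed (two-copy MD front accelerating like
√log N, or an analytic focusing-relay construction with
positive log-energy Biggins speed under Gibbs) — closes the route `refuted:LightConeInLaw`, retires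
the card and removes the locality child
of FirstFailureBlowup; file ¬LightConeInLaw as negative knowledge. ¬NearConstantShortTimeHL (an
O(1)-slow near-equilibrium mode at fixed σ)
kills this route and in substance the conjunct — operator alarm, not a pivot. ¬RestartPrinciple
alone ⇒ pivot: keep cone + near-constant
and re-target the route to S (short-time HL for all smooth profiles) as a conditional result.
DiluteSelfConsistency refuted (DenseExcursion
3090 proved) ⇒ repair by `--restate Assembly` ending at the guarded conjunct HydroLimitInBand
(3093). HydrodynamicLimit proved elsewhere
moots cruxes 3–4 but not the cone (still wanted by hydrodynamic-projection-transplant crux A and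
loschmidt-forward-autonomy-rigidity crux L).

NOT DECOMPOSED YET. The card's M1–M5 (layer-2 children of LightConeInLaw, above); the constants κ₁,
c(M) and the time grid; the covariance corollary for
Doyon's framework (hydrodynamic-projection-transplant crux A = EquilibriumLightCone + exponential
clustering of G, Ruelle1969) — filed as
support when that card is routed; the sibling's L1 (torus ⇔ ball) and L4 (σ₀ depends on the profile
only through sup ρ) corollaries; the
PDE lemmas inside ConeLocalisation (H³ lifespan ≥ c/M by scaling, C¹ amplification over r/c, domain
of dependence) ride as `--supports`
lemmas; definition requests (causal chain / infection set of a pair of HardSphereFlow trajectories;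
Palm kernel of the contact process under
canonicalDensity; GNZ equations as a cite fact) are deferred to the split of LightConeInLaw — the
typed items need none.

CHEAPEST FALSIFIER. (i) Redo triage T9's G1 computation honestly: for the best-of-2^k relay
lineages, with the flux-weighted impact-parameter law giving
P(energy share U > 1 − η | past) ≤ Cη, is the log-energy branching random walk's Biggins speed
negative (triage value inf_s log(2/(s+1))/s =
−0.23)? A positive speed means sustained focusing relays, span ~ v_th²τ²/ℓ, no N-independent c — the
engine dies. (ii) Event-driven MD,
two copies agreeing inside B_R at φ = 0.05–0.2, N = 10⁵–10⁶: the agreeing region must shrink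
linearly at speed κ√θ (+|u|), φ-independent at
leading order, fluctuations O(ℓ log N); not run here (plancard, no kit job). (iii) Sanity, done on
paper: the typed LightConeInLaw is FALSE
for the ideal gas (Maxwellian leakage carries an N-independent e^(-c²/2θ) mass fraction across any
cone) and holds trivially for system 2 =
system 1 — the statement has teeth exactly where collisions act (ℓ → 0 at fixed σ > 0).

NUMBERS. Mean free path ℓ = (√2 π (N+1) ε²)⁻¹ = (N+1)^(-1/3)/(√2πσ²) (macroscopic units); collisions
per particle per unit time ≍ √θ σ²(N+1)^(1/3);
cone overshoot δ costs e^(-cδ/ℓ) = e^(-c√2πσ²δ(N+1)^(1/3)) against ≤ (N+1) seeds × poly(N) time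
grid; predicted c(M) = M + κ₁√M with κ₁ = O(1)
from the Chernoff–entropy balance against log 2 per link; dilute hs sound speed √(5θ/3)(1 + O(φ))
must be < κ₁√θ; classical lattice LR
velocities: RazSims2009 (explicit), MarchioroEtAl1978; Biggins speed of the focusing lineage BRW
−0.23 (triage T9). Items at open: 7.

DEFINITION REQUESTS. None for the typed items (all seven decls elaborate over HardSphereEuler.lean /
HardSphereDynamics.lean / TorusCalculus.lean). Deferred to the
split of LightConeInLaw: CausalChain / InfectedSet for a pair of
`Literature.Analysis.FluidPDE.HardSphereFlow` trajectories
(topic Summits/AtomisticToContinuum/HydrodynamicLimit/Theorems); Palm kernel of the contact point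
process under `canonicalDensity`
(Literature/Probability); cite fact GNZ (Georgii–Nguyen–Zessin) equations for hard-core Gibbs point
processes. Bib: MarchioroEtAl1978 added
(doi:10.1007/bf01011695); van den Berg–Maes cited by doi:10.1214/aop/1176988728.

Novelty: Searches (2026-08-15): `lit search --source crossref "Lieb-Robinson bounds classical anharmonic
lattice systems propagation perturbation"`
(12: NachtergaeleEtAl2008, RazSims2009, Islambekov–Sims–Teschl Toda doi:10.1007/s10955-012-0554-2,
…, all lattices); `lit search --source
crossref "velocity of a perturbation infinite particle systems Newtonian dynamics bound"` (11:
MarchioroEtAl1978 doi:10.1007/bf01011695,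
Zessin 2023 doi:10.1063/5.0128104 cluster dynamics, Bahn–Park–Yoo 1999); `lit search --source
crossref "light-cone spreading of perturbations
butterfly effect classical many-body"` (14: doi:10.1103/physrevlett.121.024101,
doi:10.1103/physrevlett.121.250602 — numerical butterfly
cones in classical spin chains, no gas, no theorem); `lit galaxy search "Lieb-Robinson bound hard
sphere gas" --star all` (0 hits),
`"locality of the hydrodynamic limit" --star all` (0), `"velocity of a perturbation" --star all`
(14, noise); `lit frontier
AtomisticToContinuum --since 2020` (30 rows, nothing on locality/propagation bounds for hard
spheres); local index / OpenAlex / arXiv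
unavailable this session (searchd reset, HTTP 429) — recorded in NOTES.md; the card's own audit
(AUDIT-4-0, T9) searched 87 cards + the
same DOIs. Boards: 10 route files of the sub read; FirstFailureBlowup names 'MacroscopicLocality' as
an unfiled layer-2 child, no route
states a propagation bound.
Nearest prior art found: MarchioroEtAl1978 / ButtaEtAl2007 / RazSims2009 / NachtergaeleEtAl2008
(Lieb–Robinson-type b  [refs: 10.1007/s10955-012-0554-2, 10.1007/bf01011695, 10.1063/5.0128104, 10.1103/physrevlett.121.024101, 10.1103/physrevlett.121.250602, doi:10.1007/s10955-012-0554-2, doi:10.1007/bf01011695, doi:10.1063/5.0128104, doi:10.1103/physrevlett.121.024101, doi:10.1103/physrevlett.121.250602, NachtergaeleEtAl2008, RazSims2009, MarchioroEtAl1978, ButtaEtAl2007, Alexander1975, Dorfman1999]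

Barriers (technique_class: lieb-robinson path-counting palm-gibbs locality): - technique_class: lieb-robinson path-counting palm-gibbs locality
- Literature.Barriers.AtomisticToContinuum.HighMomentumCutoffBarrier: sidestepped for the cone —
spans are counted in flight LENGTHS, so Maxwellian tails enter only polynomial prefactors (seeds ×
time grid) against e^(-cδσ²N^(1/3)); no exponential moment of the cubic current is used; the
residual velocity issue is the energy-share bound on relays (G1), a one-collision statement.
- Literature.Barriers.AtomisticToContinuum.HighMomentumCutoffBarrierNarrow: not met — no time
derivative of a relative entropy is taken anywhere in this route.
- Literature.Barriers.AtomisticToContinuum.BoltzmannHypothesisBarrier: not in class for the cone (no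
closure, no stationary-state classification); it bites only inside NearConstantShortTimeHL, where
the bet is near-GLOBAL-equilibrium relaxation (linear response / projection onto five charges), and
the ideal-gas kernel is respected: both the cone and the near-constant theorem are false for free
flight, as they must be.
- Literature.Barriers.AtomisticToContinuum.MacroErgodicityBarrier: not met — no infinite-volume
invariant-measure classification; time iteration is posed as RestartPrinciple (finite system, finite
time), whose stated failure mode is mesoscale regularity, not ergodicity.
- Literature.Barriers.AtomisticToContinuum.DiluteRegimeBarrier: not met — σ fixed; low density
enters only through static Palm/cluster bounds (packing < η₀ guard) and ℓ/ε ≍ σ⁻³ ≫ 1; no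
Boltzmann–Gra

Novelty grade: new-combination — route-review (refuter 539a64a6) [route CLOSED by operator @13:45:56Z, not-a-thesis; findings for a re-file]: 7/7 decls elaborate (W1.lean rc0); LightConeInLaw→EquilibriumLightCone proved. Read-back clean (t=0 consistent since E linear in ρ; R≥diam𝕋³ forces σ₁=σ₂). Non-vacuous (spheres fit ∀N for σ<1 (refuter refuter-rreview-route-AtomisticToContinu-539a64a6-0, 2026-08-15T13:57:48Z; prior: doi:10.1007/bf01011695, ButtaEtAl2007, RazSims2009, NachtergaeleEtAl2008)

History (route lifecycle, newest last):
- 2026-08-15T13:45:56Z · CLOSED retired — not-a-thesis: assembly does not conclude the sub-problem Statement (operator:999:1257524)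

sub-problem: HydrodynamicLimit · status: closed(retired) · opened planner-plancard-AtomisticToContinuum-Hydrody-e9122d9c-0 2026-08-15T11:42:26Z · rev 0 · ledger route-AtomisticToContinuum-RelayRaceLightCone
GENERATED by the gate from the ledger (D-0016/17). Provers cite these decls: `theorem foo : Summit.AtomisticToContinuum.HydrodynamicLimit.Theses.RelayRaceLightCone.<Decl> := …` in Summits/AtomisticToContinuum/HydrodynamicLimit/Theorems/<Name>.lean.
-/

namespace Summit.AtomisticToContinuum.HydrodynamicLimit.Theses.RelayRaceLightCone

open scoped BigOperators Topology Manifold Classical MeasureTheory ProbabilityTheory Matrix InnerProductSpace ComplexConjugate ContinuousMap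
open Filter Set Function TopologicalSpace MeasureTheory

attribute [summit_statement] _root_.HydrodynamicLimit

/-- item stmt-AtomisticToContinuum-5772 · crux · rank 2 · closed · moot by None · by planner
why it might fail: Needs per-link Palm–Gibbs bounds with an energy-share bound (focusing relays, triage G1) and, out of equilibrium at macroscopic t, mesoscale channel/crowding regularity of the evolved law (card M2): sub-extensive events invisible to O(N) entropy; guards sit on nominal Euler fields only.
sources: MarchioroEtAl1978, ButtaEtAl2007, RazSims2009, NachtergaeleEtAl2008, Alexander1975, Ruelle1969
[crux] LIGHT CONE IN LAW (card relay-race-light-cone LR-G/M1–M5 + sibling graft G2/G3). ∃ η₀ ∀ M ∃ c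
> 0: for two hard-sphere systems on 𝕋³ with the SAME diameter hsDiameter σ₁ N — system 1 the
conjunct's (N+1 spheres, local Gibbs profile (a₁,u₁,θ₁), reduced density σ₁) and system 2 any
comparison gas (n₂(N) spheres, n₂·ε³ → σ₂³, local Gibbs profile (a₂,u₂,θ₂)) — whose laws are
probability measures with LLN at t = 0 towards classical hs-Euler data (solutions on [0,T₁), [0,T₂))
that AGREE on the ball B(x₀,R) in reduced units (ρσ³, u, θ), and whose nominal fields obey packing <
η₀, θ ≤ M, |u| ≤ M on [0,t]: for every continuous χ vanishing outside B(x₀, R − c t) and every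
1-Lipschitz F bounded by 1, E₁ F(reduced fields of Φ_t z against χ) − E₂ F(…) → 0 as N → ∞. Intended
proof = the card: relay-race path counting (≤ 2^k chains), per-link conditional Palm–Gibbs bounds
(flight-length exponential moments, short-gap bound, ENERGY-SHARE bound against focusing relays),
Chernoff by iterated conditioning, union over seeds/time grid, two-copy infection coupling;
equilibrium case first (support EquilibriumLightCone), macroscopic times via mesoscale
channel/crowding regularity (card M2) or short -/
@[route_item "route-AtomisticToContinuum-RelayRaceLightCone"]
def LightConeInLaw : Prop :=
  open Literature.MathematicalPhysics.KineticTheory Literature.Analysis.FluidPDE MeasureTheory Filter in ∃ η₀ : ℝ, 0 < η₀ ∧ ∀ M : ℝ, 0 < M → ∃ c : ℝ, 0 < c ∧ ∀ (a₁ θ₁ a₂ θ₂ : T3 → ℝ) (u₁ u₂ : T3 → V3), Continuous a₁ → Continuous θ₁ → Continuous u₁ → Continuous a₂ → Continuous θ₂ → Continuous u₂ → (∀ x, 0 < a₁ x) → (∀ x, 0 < θ₁ x) → (∀ x, 0 < a₂ x) → (∀ x, 0 < θ₂ x) → ∃ σ₀ : ℝ, 0 < σ₀ ∧ ∀ (σ₁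 σ₂ : ℝ), 0 < σ₁ → σ₁ < σ₀ → 0 < σ₂ → σ₂ < σ₀ → ∀ n₂ : ℕ → ℕ, Tendsto (fun N => (n₂ N : ℝ) * hsDiameter σ₁ N ^ 3) atTop (nhds (σ₂ ^ 3)) → ∀ (T₁ T₂ : ℝ) (ρ₁ Θ₁ ρ₂ Θ₂ : ℝ → T3 → ℝ) (U₁ U₂ : ℝ → T3 → V3), IsHardSphereEulerSolution σ₁ T₁ ρ₁ U₁ Θ₁ → IsHardSphereEulerSolution σ₂ T₂ ρ₂ U₂ Θ₂ → ∀ (Φ₁ : (N : ℕ) → HardSphereFlow (Torus.geometry (Fin 3)) (hsDiameter σ₁ N) (N + 1)) (Φ₂ : (N : ℕ) → HardSphereFlow (Torus.geometry (Fin 3)) (hsDiameter σ₁ N) (n₂ N)), let P₁ : (N : ℕ) → Measure (Config (N + 1) (Fin 3) T3) := fun N => localGibbsLaw σ₁ a₁ u₁ θ₁ N (Φ₁ N); let P₂ : (N : ℕ) → Measure (Config (n₂ N) (Fin 3) T3) := fun N => particleLaw (Φ₂ N) (canonicalDensity (Torus.geometry (Fin 3)) (hsDiameter σ₁ N) (n₂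 N) (localGibbsProfile a₂ u₂ θ₂)); (∀ N, IsProbabilityMeasure (P₁ N)) → (∀ N, IsProbabilityMeasure (P₂ N)) → TendstoHydroFieldsAt P₁ Φ₁ ρ₁ U₁ Θ₁ 0 → (∀ χ : T3 → ℝ, Continuous χ → ∀ δ : ℝ, 0 < δ → Tendsto (fun N => P₂ N {z | δ < |empiricalDensityField ((Φ₂ N).flow 0 z) χ - ∫ x, χ x * ρ₂ 0 x|}) atTop (nhds 0) ∧ Tendsto (fun N => P₂ N {z | δ < ‖empiricalMomentumField ((Φ₂ N).flow 0 z) χ - ∫ x, (χ x * ρ₂ 0 x) • U₂ 0 x‖}) atTop (nhds 0) ∧ Tendsto (fun N => P₂ N {z | δ < |empiricalEnergyField ((Φ₂ N).flow 0 z) χ - ∫ x, χ x * totalEnergyDensity (ρ₂ 0 x) (U₂ 0 x) (Θ₂ 0 x)|}) atTop (nhds 0)) → ∀ t : ℝ, 0 ≤ t → t < T₁ → t < T₂ → (∀ s ∈ Set.Icc 0 t, ∀ x, ρ₁ s x * σ₁ ^ 3 < η₀ ∧ Θ₁ s x ≤ M ∧ ‖U₁ s x‖ ≤ M ∧ ρ₂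 s x * σ₂ ^ 3 < η₀ ∧ Θ₂ s x ≤ M ∧ ‖U₂ s x‖ ≤ M) → ∀ (x₀ : T3) (R : ℝ), (∀ x, Torus.euclidDist x x₀ < R → ρ₁ 0 x * σ₁ ^ 3 = ρ₂ 0 x * σ₂ ^ 3 ∧ U₁ 0 x = U₂ 0 x ∧ Θ₁ 0 x = Θ₂ 0 x) → ∀ χ : T3 → ℝ, Continuous χ → (∀ x, R - c * t ≤ Torus.euclidDist x x₀ → χ x = 0) → ∀ F : ℝ × V3 × ℝ → ℝ, LipschitzWith 1 F → (∀ p, |F p| ≤ 1) → Tendsto (fun N => (∫ z, F (σ₁ ^ 3 * empiricalDensityField ((Φ₁ N).flow t z) χ, (σ₁ ^ 3) • empiricalMomentumField ((Φ₁ N).flow t z) χ, σ₁ ^ 3 * empiricalEnergyField ((Φ₁ N).flow t z) χ) ∂(P₁ N)) - ∫ z, F (σ₂ ^ 3 * empiricalDensityField ((Φ₂ N).flow t z) χ, (σ₂ ^ 3) • empiricalMomentumField ((Φ₂ N).flow t z) χ, σ₂ ^ 3 * empiricalEnergyField ((Φ₂ N).flow t z) χ) ∂(P₂ N)) atTop (nhds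 0)

/-- item stmt-AtomisticToContinuum-5773 · crux · rank 3 · closed · moot by None · by planner
why it might fail: It is the near-equilibrium hydrodynamic limit at fixed σ (relaxation of shear/sound/heat modes of deterministic spheres; open even linearised, Spohn1991 §7.1 (7.13)-(7.18)), asked uniformly in M with C¹ guards only; one O(1)-slow non-hydrodynamic mode near equilibrium kills it.
sources: Spohn1991, BGSSCPAM2023, OllaVaradhanYau1993, Doyon2022
[crux] NEAR-CONSTANT SHORT-TIME HYDRODYNAMIC LIMIT, general diameter/number families (foreign input;
cf. FirstFailureBlowup's C²-small SmallDataHydrodynamics stmt-3332 — here only C⁰-AMPLITUDE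
smallness δ₀(M) at t = 0 plus C¹ GUARDS M on [0,t], because the flattened comparison profiles of
ConeLocalisation have O(1) gradients and O(1/r) second derivatives). ∃ η₀ ∀ M ∃ δ₀, τ₀ > 0 ∀
continuous positive profiles ∃ σ₀ ∀ σ < σ₀ ∀ families (ε_N → 0, n_N ε_N³ → σ³) ∀ classical hs-Euler
solutions with |ρ(0) − 1|, |u(0) − ū|, |θ(0) − θ̄| ≤ δ₀ ∀ flows: if the canonical local Gibbs laws
are probability measures with LLN at 0, then for t < min(T, τ₀), provided packing < η₀, θ ∈ [1/M,
M], |u| ≤ M and all first Torus.partialDeriv ≤ M on [0,t], the three empirical fields satisfy the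
LLN at t. [difficulty: open-problem] -/
@[route_item "route-AtomisticToContinuum-RelayRaceLightCone"]
def NearConstantShortTimeHL : Prop :=
  open Literature.MathematicalPhysics.KineticTheory Literature.Analysis.FluidPDE Literature.Analysis.FunctionSpaces MeasureTheory Filter in ∃ η₀ : ℝ, 0 < η₀ ∧ ∀ M : ℝ, 0 < M → ∃ δ₀ : ℝ, 0 < δ₀ ∧ ∃ τ₀ : ℝ, 0 < τ₀ ∧ ∀ (a₀ θ₀ : T3 → ℝ) (u₀ : T3 → V3), Continuous a₀ → Continuous θ₀ → Continuous u₀ → (∀ x, 0 < a₀ x) → (∀ x, 0 < θ₀ x) → ∃ σ₀ : ℝ, 0 < σ₀ ∧ ∀ σ : ℝ, 0 < σ → σ < σ₀ → ∀ (ε : ℕ → ℝ) (n : ℕ → ℕ), (∀ N, 0 < ε N) → Tendsto ε atTop (nhds 0) → Tendsto (fun N => (n N : ℝ) * ε N ^ 3) atTop (nhds (σ ^ 3)) → ∀ (T : ℝ) (ρ θ : ℝ → T3 → ℝ) (u : ℝ → T3 → V3), IsHardSphereEulerSolution σ T ρ u θ → (∃ (ubar : V3) (θbar : ℝ), ∀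 x, |ρ 0 x - 1| ≤ δ₀ ∧ ‖u 0 x - ubar‖ ≤ δ₀ ∧ |θ 0 x - θbar| ≤ δ₀) → ∀ Φ : (N : ℕ) → HardSphereFlow (Torus.geometry (Fin 3)) (ε N) (n N), let P : (N : ℕ) → Measure (Config (n N) (Fin 3) T3) := fun N => particleLaw (Φ N) (canonicalDensity (Torus.geometry (Fin 3)) (ε N) (n N) (localGibbsProfile a₀ u₀ θ₀)); (∀ N, IsProbabilityMeasure (P N)) → (∀ χ : T3 → ℝ, Continuous χ → ∀ δ : ℝ, 0 < δ → Tendsto (fun N => P N {z | δ < |empiricalDensityField ((Φ N).flow 0 z) χ - ∫ x, χ x * ρ 0 x|}) atTop (nhds 0) ∧ Tendsto (fun N => P N {z | δ < ‖empiricalMomentumField ((Φ N).flow 0 z) χ - ∫ x, (χ x * ρ 0 x) • u 0 x‖}) atTop (nhds 0) ∧ Tendsto (fun N => P N {z | δ < |empiricalEnergyField ((Φ N).flow 0 z) χ - ∫ x, χ x * totalEnergyDensity (ρ 0 x) (u 0 x) (θ 0 x)|}) atTop (nhds 0)) → ∀ t ∈ Set.Ico 0 (min T τ₀), (∀ s ∈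 Set.Icc 0 t, ∀ x, ρ s x * σ ^ 3 < η₀ ∧ θ s x ≤ M ∧ M⁻¹ ≤ θ s x ∧ ‖u s x‖ ≤ M ∧ ∀ i : Fin 3, |Torus.partialDeriv i (ρ s) x| ≤ M ∧ ‖Torus.partialDeriv i (u s) x‖ ≤ M ∧ |Torus.partialDeriv i (θ s) x| ≤ M) → ∀ χ : T3 → ℝ, Continuous χ → ∀ δ : ℝ, 0 < δ → Tendsto (fun N => P N {z | δ < |empiricalDensityField ((Φ N).flow t z) χ - ∫ x, χ x * ρ t x|}) atTop (nhds 0) ∧ Tendsto (fun N => P N {z | δ < ‖empiricalMomentumField ((Φ N).flow t z) χ - ∫ x, (χ x * ρ t x) • u t x‖}) atTop (nhds 0) ∧ Tendsto (fun N => P N {z | δ < |empiricalEnergyField ((Φ N).flow t z) χ - ∫ x, χ x * totalEnergyDensity (ρ t x) (u t x) (θ t x)|}) atTop (nhds 0)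

/-- item stmt-AtomisticToContinuum-5774 · crux · rank 4 · closed · moot by None · by planner
why it might fail: The time-τ₁ law is not local Gibbs: o(N) relative entropy transfers only e^(-cN)-rare events while cone/relaxation bounds are e^(-cN^(1/3)); restart needs S for entropy-close data (3329-3331 currency) = mesoscale regularity along the true law, unproved.
sources: Yau1991, OllaVaradhanYau1993, KipnisLandim1999, Spohn1991
[crux] RESTART: the short-time guarded hydrodynamic limit S (∃ η₀ ∀ M ∃ τ₁ > 0: for every
profile/σ/classical solution of the conjunct's family with LLN at 0, the LLN holds at every t <
min(T, τ₁) at which packing < η₀, ρ ≤ M, θ ∈ [1/M, M], |u| ≤ M and all Torus.partialDeriv of (ρ,u,θ)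
up to order 3 are ≤ M on [0,t]) IMPLIES the packing-guarded conjunct (body of HydroLimitInBand,
stmt-3093: ∃ η₀ ∀ profiles ∃ σ₀ ∀ σ < σ₀ ∀ solutions with ρ_tσ³ < η₀ on [0,T), LLN at 0 ⇒ LLN at all
t < T). Content: a finite restart induction with step τ₁(M(t)) along the given solution (M(t) = C³
bound on [0,t]); the law at a restart time is not local Gibbs, so S must be re-proved in a
restartable currency — entropy-close data (FirstFailureBlowup: ShortTimePropagation 3329,
RestartEntropy 3330, ProfileRealisability 3331) or Liouville-pinned entropy (card restart-principle)
— which for this route means the cone and the near-constant theorem under mesoscale regularity of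
the TRUE law (card M2). [deps: NearConstantShortTimeHL] [difficulty: XL] -/
@[route_item "route-AtomisticToContinuum-RelayRaceLightCone"]
def RestartPrinciple : Prop :=
  open Literature.MathematicalPhysics.KineticTheory Literature.Analysis.FluidPDE Literature.Analysis.FunctionSpaces MeasureTheory Filter in (∃ η₀ : ℝ, 0 < η₀ ∧ ∀ M : ℝ, 0 < M → ∃ τ₁ : ℝ, 0 < τ₁ ∧ ∀ (a₀ θ₀ : T3 → ℝ) (u₀ : T3 → V3), Continuous a₀ → Continuous θ₀ → Continuous u₀ → (∀ x, 0 < a₀ x) → (∀ x, 0 < θ₀ x) → ∃ σ₀ : ℝ, 0 < σ₀ ∧ ∀ σ : ℝ, 0 < σ → σ < σ₀ → ∀ (T : ℝ) (ρ θ : ℝ → T3 → ℝ) (u : ℝ → T3 → V3), IsHardSphereEulerSolution σ T ρ u θ → ∀ Φ : (N : ℕ) → HardSphereFlow (Torus.geometry (Fin 3)) (hsDiameter σ N) (N + 1), TendstoHydroFieldsAt (fun N => localGibbsLaw σ a₀ u₀ θ₀ N (Φ N)) Φ ρ u θ 0 → ∀ t ∈ Set.Ico 0 (min T τ₁), (∀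 s ∈ Set.Icc 0 t, ∀ x, ρ s x * σ ^ 3 < η₀ ∧ ρ s x ≤ M ∧ θ s x ≤ M ∧ M⁻¹ ≤ θ s x ∧ ‖u s x‖ ≤ M ∧ ∀ i j k : Fin 3, |Torus.partialDeriv i (ρ s) x| ≤ M ∧ ‖Torus.partialDeriv i (u s) x‖ ≤ M ∧ |Torus.partialDeriv i (θ s) x| ≤ M ∧ |Torus.partialDeriv i (Torus.partialDeriv j (ρ s)) x| ≤ M ∧ ‖Torus.partialDeriv i (Torus.partialDeriv j (u s)) x‖ ≤ M ∧ |Torus.partialDeriv i (Torus.partialDeriv j (θ s)) x| ≤ M ∧ |Torus.partialDeriv i (Torus.partialDeriv j (Torus.partialDeriv k (ρ s))) x| ≤ M ∧ ‖Torus.partialDeriv i (Torus.partialDeriv j (Torus.partialDeriv k (u s))) x‖ ≤ M ∧ |Torus.partialDeriv i (Torus.partialDeriv j (Torus.partialDeriv k (θ s))) x| ≤ M) → TendstoHydroFieldsAt (fun N => localGibbsLaw σ a₀ u₀ θ₀ N (Φ N)) Φ ρ u θ t) → (∃ η₀ : ℝ, 0 < η₀ ∧ ∀ (a₀ θ₀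 : T3 → ℝ) (u₀ : T3 → V3), Continuous a₀ → Continuous θ₀ → Continuous u₀ → (∀ x, 0 < a₀ x) → (∀ x, 0 < θ₀ x) → ∃ σ₀ : ℝ, 0 < σ₀ ∧ ∀ σ : ℝ, 0 < σ → σ < σ₀ → ∀ (T : ℝ) (ρ θ : ℝ → T3 → ℝ) (u : ℝ → T3 → V3), IsHardSphereEulerSolution σ T ρ u θ → (∀ t ∈ Set.Ico 0 T, ∀ x, ρ t x * σ ^ 3 < η₀) → ∀ Φ : (N : ℕ) → HardSphereFlow (Torus.geometry (Fin 3)) (hsDiameter σ N) (N + 1), TendstoHydroFieldsAt (fun N => localGibbsLaw σ a₀ u₀ θ₀ N (Φ N)) Φ ρ u θ 0 → ∀ t ∈ Set.Ico 0 T, TendstoHydroFieldsAt (fun N => localGibbsLaw σ a₀ u₀ θ₀ N (Φ N)) Φ ρ u θ t)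

/-- item stmt-AtomisticToContinuum-3091 · support · rank 9 · open · by planner
sources: Sideris1985, LukSpeck2024, Spohn1991
[crux] (card crux 1B ∪ 3; the hidden PDE crux of every route) for every η > 0 and all continuous
positive profiles there is σ₀ > 0 such that for 0 < σ < σ₀, every classical hard-sphere-Euler
solution on [0,T) whose t = 0 fields are the LLN limit of the local Gibbs laws satisfies ρ_t(x)σ³ <
η for all t < T and x — i.e. limsup_{σ→0} σ³ sup_{t<T*_σ} ‖ρ_σ(t)‖_∞ = 0 profile by profile. For
profiles whose ideal-gas development is global or breaks by a non-degenerate shock (Luk–Speck /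
Buckmaster–Shkoller–Vicol open sets) this is stability of shock formation under an O(σ³)
equation-of-state and data perturbation; in general it is a σ-uniform density bound at the FIRST
singularity of 3-D compressible Euler for all smooth data. [deps: EosContinuity,
LocalGibbsDensityLimit] [difficulty: open-problem] -/
@[route_item "route-AtomisticToContinuum-RelayRaceLightCone"]
def DiluteSelfConsistency : Prop :=
  ∀ η : ℝ, 0 < η → ∀ (a₀ θ₀ : Literature.MathematicalPhysics.KineticTheory.T3 → ℝ) (u₀ : Literature.MathematicalPhysics.KineticTheory.T3 → Literature.MathematicalPhysics.KineticTheory.V3), Continuous a₀ → Continuous θ₀ → Continuous u₀ → (∀ x, 0 < a₀ x) → (∀ x, 0 < θ₀ x) → ∃ σ₀ : ℝ, 0 < σ₀ ∧ ∀ σ : ℝ, 0 < σ → σ < σ₀ → ∀ (T : ℝ) (ρ θ : ℝ → Literature.MathematicalPhysics.KineticTheory.T3 → ℝ) (u : ℝ → Literature.MathematicalPhysics.KineticTheory.T3 → Literature.MathematicalPhysics.KineticTheory.V3), Literature.MathematicalPhysics.KineticTheory.IsHardSphereEulerSolution σ T ρ u θ → ∀ Φ : (N : ℕ) → Literature.Analysis.FluidPDE.HardSphereFlow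 (Literature.Analysis.FluidPDE.Torus.geometry (Fin 3)) (Literature.MathematicalPhysics.KineticTheory.hsDiameter σ N) (N + 1), Literature.MathematicalPhysics.KineticTheory.TendstoHydroFieldsAt (fun N => Literature.MathematicalPhysics.KineticTheory.localGibbsLaw σ a₀ u₀ θ₀ N (Φ N)) Φ ρ u θ 0 → ∀ t ∈ Set.Ico 0 T, ∀ x, ρ t x * σ ^ 3 < η

/-- item stmt-AtomisticToContinuum-5775 · support · rank 9 · closed · moot by None · by planner
sources: Kato1975, Majda1984, Sideris1985, Spohn1991, Rauch1986
[support] GLUE (small ⇒ large for short times; sibling graft L2 without zoom): LightConeInLaw →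
NearConstantShortTimeHL → S (S as in RestartPrinciple). Proof plan: given a profile with C³ bounds M
on [0,t] and x₀, flatten the Euler data outside B(x₀,2r) by a cutoff at scale r towards the constant
state (ρ(0,x₀), u(0,x₀), θ(0,x₀)) (amplitude ≤ C M r, gradients ≤ C M); realise it as system 2 with
n₂(N) = ⌈ρ(0,x₀)(N+1)⌉ spheres of the same diameter (normalised density ≈ 1, σ₂ = ρ(0,x₀)^(1/3)σ)
and a local Gibbs activity with LLN (statics: LocalGibbsDensityLimit 3097 / LocalGibbsConcentration
0767); its classical solution lives ≥ c/M by scaling + H³ local theory (Kato1975, Majda1984) and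
keeps C¹ norm ≤ C'M up to time r/c; Euler domain of dependence identifies it with the original
solution inside the shrinking ball; the cone transfers the LLN for test functions supported in B(x₀,
r − c t), t ≤ τ₁ := min(τ₀(C'M), r/c(M)); a partition of unity over x₀ finishes. Needs no new
definitions. [difficulty: L] -/
@[route_item "route-AtomisticToContinuum-RelayRaceLightCone"]
def ConeLocalisation : Prop :=
  open Literature.MathematicalPhysics.KineticTheory Literature.Analysis.FluidPDE Literature.Analysis.FunctionSpaces MeasureTheory Filter in LightConeInLaw → NearConstantShortTimeHL → (∃ η₀ : ℝ, 0 < η₀ ∧ ∀ M : ℝ, 0 < M → ∃ τ₁ : ℝ, 0 < τ₁ ∧ ∀ (a₀ θ₀ : T3 → ℝ) (u₀ : T3 → V3), Continuous a₀ → Continuous θ₀ → Continuous u₀ → (∀ x, 0 < a₀ x) → (∀ x, 0 < θ₀ x) → ∃ σ₀ : ℝ, 0 < σ₀ ∧ ∀ σ : ℝ, 0 < σ → σ < σ₀ → ∀ (T : ℝ) (ρ θ : ℝ → T3 → ℝ) (u : ℝ → T3 → V3), IsHardSphereEulerSolution σ T ρ u θ → ∀ Φ : (N : ℕ) → HardSphereFlow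 (Torus.geometry (Fin 3)) (hsDiameter σ N) (N + 1), TendstoHydroFieldsAt (fun N => localGibbsLaw σ a₀ u₀ θ₀ N (Φ N)) Φ ρ u θ 0 → ∀ t ∈ Set.Ico 0 (min T τ₁), (∀ s ∈ Set.Icc 0 t, ∀ x, ρ s x * σ ^ 3 < η₀ ∧ ρ s x ≤ M ∧ θ s x ≤ M ∧ M⁻¹ ≤ θ s x ∧ ‖u s x‖ ≤ M ∧ ∀ i j k : Fin 3, |Torus.partialDeriv i (ρ s) x| ≤ M ∧ ‖Torus.partialDeriv i (u s) x‖ ≤ M ∧ |Torus.partialDeriv i (θ s) x| ≤ M ∧ |Torus.partialDeriv i (Torus.partialDeriv j (ρ s)) x| ≤ M ∧ ‖Torus.partialDeriv i (Torus.partialDeriv j (u s)) x‖ ≤ M ∧ |Torus.partialDeriv i (Torus.partialDeriv j (θ s)) x| ≤ M ∧ |Torus.partialDeriv i (Torus.partialDeriv j (Torus.partialDeriv k (ρ s))) x| ≤ M ∧ ‖Torus.partialDeriv i (Torus.partialDeriv j (Torus.partialDeriv k (u s))) x‖ ≤ M ∧ |Torus.partialDeriv i (Torus.partialDeriv j (Torus.partialDeriv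 k (θ s))) x| ≤ M) → TendstoHydroFieldsAt (fun N => localGibbsLaw σ a₀ u₀ θ₀ N (Φ N)) Φ ρ u θ t)

/-- item stmt-AtomisticToContinuum-5776 · support · rank 9 · closed · moot by None · by planner
sources: MarchioroEtAl1978, Alexander1975, Ruelle1969, Dorfman1999
[support] SPECIAL CASE & FIRST MILESTONE (card's equilibrium theorem LR-G in two-copy form):
LightConeInLaw with system 1 restricted to CONSTANT profiles (global Gibbs law, invariant under
every hard-sphere flow): the uninfected region ahead of the infection front then has equilibrium
statistics in both copies, so only STATIC Palm–Gibbs per-link bounds (card M1) and the relay-race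
assembly (M3) are needed — no channel regularity (M2). MD-testable (two-copy infection front: speed
κ₁√θ independent of φ at leading order, front width O(ℓ log N)). Implied by LightConeInLaw
(one-line, in Sketch.lean). [difficulty: XL] -/
@[route_item "route-AtomisticToContinuum-RelayRaceLightCone"]
def EquilibriumLightCone : Prop :=
  open Literature.MathematicalPhysics.KineticTheory Literature.Analysis.FluidPDE MeasureTheory Filter in ∃ η₀ : ℝ, 0 < η₀ ∧ ∀ M : ℝ, 0 < M → ∃ c : ℝ, 0 < c ∧ ∀ (a₁ θ₁ a₂ θ₂ : T3 → ℝ) (u₁ u₂ : T3 → V3), Continuous a₁ → Continuous θ₁ → Continuous u₁ → Continuous a₂ → Continuous θ₂ → Continuous u₂ → (∀ x, 0 < a₁ x) → (∀ x, 0 < θ₁ x) → (∀ x, 0 < a₂ x) → (∀ x, 0 < θ₂ x) → (∀ x y, a₁ x = a₁ y) → (∀ x y, θ₁ x = θ₁ y) → (∀ x y, u₁ x = u₁ y) → ∃ σ₀ : ℝ, 0 < σ₀ ∧ ∀ (σ₁ σ₂ : ℝ), 0 < σ₁ → σ₁ < σ₀ → 0 < σ₂ → σ₂ < σ₀ → ∀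 n₂ : ℕ → ℕ, Tendsto (fun N => (n₂ N : ℝ) * hsDiameter σ₁ N ^ 3) atTop (nhds (σ₂ ^ 3)) → ∀ (T₁ T₂ : ℝ) (ρ₁ Θ₁ ρ₂ Θ₂ : ℝ → T3 → ℝ) (U₁ U₂ : ℝ → T3 → V3), IsHardSphereEulerSolution σ₁ T₁ ρ₁ U₁ Θ₁ → IsHardSphereEulerSolution σ₂ T₂ ρ₂ U₂ Θ₂ → ∀ (Φ₁ : (N : ℕ) → HardSphereFlow (Torus.geometry (Fin 3)) (hsDiameter σ₁ N) (N + 1)) (Φ₂ : (N : ℕ) → HardSphereFlow (Torus.geometry (Fin 3)) (hsDiameter σ₁ N) (n₂ N)), let P₁ : (N : ℕ) → Measure (Config (N + 1) (Fin 3) T3) := fun N => localGibbsLaw σ₁ a₁ u₁ θ₁ N (Φ₁ N); let P₂ : (N : ℕ) → Measure (Config (n₂ N) (Fin 3) T3) := fun N => particleLaw (Φ₂ N) (canonicalDensity (Torus.geometry (Fin 3)) (hsDiameter σ₁ N) (n₂ N) (localGibbsProfile a₂ u₂ θ₂)); (∀ N, IsProbabilityMeasure (P₁ N)) → (∀ N,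 IsProbabilityMeasure (P₂ N)) → TendstoHydroFieldsAt P₁ Φ₁ ρ₁ U₁ Θ₁ 0 → (∀ χ : T3 → ℝ, Continuous χ → ∀ δ : ℝ, 0 < δ → Tendsto (fun N => P₂ N {z | δ < |empiricalDensityField ((Φ₂ N).flow 0 z) χ - ∫ x, χ x * ρ₂ 0 x|}) atTop (nhds 0) ∧ Tendsto (fun N => P₂ N {z | δ < ‖empiricalMomentumField ((Φ₂ N).flow 0 z) χ - ∫ x, (χ x * ρ₂ 0 x) • U₂ 0 x‖}) atTop (nhds 0) ∧ Tendsto (fun N => P₂ N {z | δ < |empiricalEnergyField ((Φ₂ N).flow 0 z) χ - ∫ x, χ x * totalEnergyDensity (ρ₂ 0 x) (U₂ 0 x) (Θ₂ 0 x)|}) atTop (nhds 0)) → ∀ t : ℝ, 0 ≤ t → t < T₁ → t < T₂ → (∀ s ∈ Set.Icc 0 t, ∀ x, ρ₁ s x * σ₁ ^ 3 < η₀ ∧ Θ₁ s x ≤ M ∧ ‖U₁ s x‖ ≤ M ∧ ρ₂ s x * σ₂ ^ 3 < η₀ ∧ Θ₂ s x ≤ M ∧ ‖U₂ s x‖ ≤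 M) → ∀ (x₀ : T3) (R : ℝ), (∀ x, Torus.euclidDist x x₀ < R → ρ₁ 0 x * σ₁ ^ 3 = ρ₂ 0 x * σ₂ ^ 3 ∧ U₁ 0 x = U₂ 0 x ∧ Θ₁ 0 x = Θ₂ 0 x) → ∀ χ : T3 → ℝ, Continuous χ → (∀ x, R - c * t ≤ Torus.euclidDist x x₀ → χ x = 0) → ∀ F : ℝ × V3 × ℝ → ℝ, LipschitzWith 1 F → (∀ p, |F p| ≤ 1) → Tendsto (fun N => (∫ z, F (σ₁ ^ 3 * empiricalDensityField ((Φ₁ N).flow t z) χ, (σ₁ ^ 3) • empiricalMomentumField ((Φ₁ N).flow t z) χ, σ₁ ^ 3 * empiricalEnergyField ((Φ₁ N).flow t z) χ) ∂(P₁ N)) - ∫ z, F (σ₂ ^ 3 * empiricalDensityField ((Φ₂ N).flow t z) χ, (σ₂ ^ 3) • empiricalMomentumField ((Φ₂ N).flow t z) χ, σ₂ ^ 3 * empiricalEnergyField ((Φ₂ N).flow t z) χ) ∂(P₂ N)) atTop (nhds 0)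

/-- item stmt-AtomisticToContinuum-5777 · assembly · rank 1 · closed · moot by None · by planner
sources: Spohn1991
[assembly] LightConeInLaw → NearConstantShortTimeHL → ConeLocalisation → RestartPrinciple →
DiluteSelfConsistency → HydrodynamicLimit. -/
@[route_item "route-AtomisticToContinuum-RelayRaceLightCone"]
def Assembly : Prop :=
  LightConeInLaw → NearConstantShortTimeHL → ConeLocalisation → RestartPrinciple → DiluteSelfConsistency → Literature.MathematicalPhysics.KineticTheory.HydrodynamicLimit

end Summit.AtomisticToContinuum.HydrodynamicLimit.Theses.RelayRaceLightCone
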